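import Literature.AlgebraicGeometry.AbelianSchemes.CechH1CountOfFiniteFlatQuotient
import Literature.AlgebraicGeometry.AbelianSchemes.MumfordPoincareOfFiniteFlatKernel
import Literature.AlgebraicGeometry.AbelianSchemes.AbelianLiftOfIsUnitTwo
import HarnessLib
import HarnessLib.Audit.LibrarySuggestionsDenyListCruxes

/-!
# F0 · P6b — ★ RE-HOME TWIN (T2′) of the sub-line «FLATQUOT»: the quotient `A⁄Z` by a finite flat closed subgroup scheme (§Q), the descent of
# the Mumford bundle to the Poincaré sheaf (§D), flat Poincaré data over every algebraically closed field, and the parent's socket §1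

Cell hodgecm-mathlib, FLOOR 0, P6 «MOD programme» Row 4 (road 4B), sub-desk P6b; crux `HLiu418` (stmt-HodgeConjecture-24832) of route
HCCMUnconditional.  HC_CM is proved only modulo the printed citations until rung 0 closes; this file changes no count (count-neutral ★ on
`--supports stmt-HodgeConjecture-24832`).  Nothing here is about HC.

THIS FILE is the Theorems-purity twin of the crux workfile `Cruxes/HLiu418/Lines/F0_P6b_MumfordDualFlat.lean` ED. 4 (commit bc55e28504c2,
sha16 bbf80a92f17c1846; full history in its module docstring) under the namespace `Summit.HodgeConjecture.HodgeConjecture.Cruxes.HLiu418.F0P6bFlatQuotient`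
(the `Lines` original keeps `…F0P6bMumfordDualFlat`), so that `Theorems/` files can import the P6b package without importing a `Cruxes/…/Lines`
module (desk F0P6b-plan (g14), LEAD «M-153u» (1)(4)).  The FOUR head STATEMENTS are token-for-token those of the original:
  §Q `stub_L4B1uQ_quotientByFiniteFlatSubgroup` — over a Noetherian local affine base, the quotient of an abelian scheme by a finite flat closed
     subgroup scheme is an abelian scheme, the quotient map a finite flat surjective homomorphism with that kernel on points, relative dimension
     kept ([SGA3I] Exp. V Thm. 4.1, [GortzWedhorn2023] Thm. 27.68 ∕ Prop. 27.62 ∕ Cor. 27.177 (1), [MumfordAV1970] §12 Thm. 1) — here PAID BY ★ TERM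
     over the Literature re-home ★ `AbelianSchemeOver.exists_quotient_of_finiteFlat_closedSubgroup` (`AbelianSchemes/CechH1CountOfFiniteFlatQuotient.lean`,
     «L2» LA2-p04 (g10), whose body IS the original 90-line torsor-quotient proof);
  §D `stub_L4B1uD_mumfordLambdaDescent` — descent of `Λ(L)` along `1 × π` to a rank-one `𝒫` on `A × Â` with homogeneous fibre restrictions
     ([MumfordAV1970] §13 Theorem, §8) — PAID BY ★ TERM over ★ `AbelianSchemeOver.exists_poincare_of_finiteFlatKernel`
     (`AbelianSchemes/MumfordPoincareOfFiniteFlatKernel.lean` ED. 2, F0P3a-p09 (g28)), verbatim the original's ED. 4 body;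
  glue `forall_flatPoincareData_of_stubs` (§Q + §D ⇒ the hypothesis `hMD` of ★ `MumfordDual.hH1_of_forall_flatPoincareData`) and the junction
  `stub_L4B1u_of_flatQuotient_of_descent` (§Q + §D ⇒ the parent's socket §1 `stub_L4B1u_abelianLiftOfIsUnitTwo`, via ★ p852865
  `AbelianSchemeOver.exists_abelianLift_of_isUnit_two`) — bodies verbatim.
Sorry-free; axioms of every theorem = [propext, Classical.choice, Quot.sound]; no instance, no notation.

## References
* [SGA3I] M. Demazure, A. Grothendieck (eds.), *SGA 3, Tome I*, LNM 151 (1970), Exp. V (P. Gabriel), Thm. 4.1.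
* [GortzWedhorn2023] U. Görtz, T. Wedhorn, *Algebraic Geometry II*, Springer (2023), Thm. 27.68, Prop. 27.62, Cor. 27.177 (1), Prop. 27.176.
* [MumfordAV1970] D. Mumford, *Abelian Varieties*, Oxford UP (1970), §8 (p. 77), §12 Thm. 1 (p. 111), §13 Theorem (p. 125) and Cor. 2 (p. 129).
* [Oort1971] F. Oort, *Finite group schemes, local moduli for abelian varieties, and lifting problems*, Compositio Math. 23 (1971), Thm. (2.2.1) (p. 273).
-/

noncomputable section

set_option autoImplicit false
set_option linter.dupNamespace false  -- `Summit.HodgeConjecture.HodgeConjecture.…` BY DESIGN (D-0017), as in the parent line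

-- `Scheme.Modules` / cartesian-monoidal `Over` products agree only at default transparency (as in ★ `CechH1DimOfPoincareData`).
set_option backward.isDefEq.respectTransparency false

open CategoryTheory CategoryTheory.Limits AlgebraicGeometry MonoidalCategory CartesianMonoidalCategory IsLocalRing
open scoped MonObj

namespace Summit.HodgeConjecture.HodgeConjecture.Cruxes.HLiu418.F0P6bFlatQuotient

open Literature.AlgebraicGeometry.AbelianSchemes Literature.AlgebraicGeometry.Motives Literature.AlgebraicGeometry.AbelianVarieties
open Literature.AlgebraicGeometry.Modules Literature.AlgebraicGeometry

/-! ## §Q (BANKED) Quotient of an abelian scheme by a finite flat closed subgroup scheme -/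

/-- **§Q `stub_L4B1uQ` (PAID BY ★ TERM, ED. 3 — [SGA3I] Exp. V Thm. 4.1, [GortzWedhorn2023] Thm. 27.68 + Prop. 27.62, [MumfordAV1970] §12 Thm. 1).**  Over a
Noetherian LOCAL affine base `Spec R` (ED. 3 re-cut «D-g14-1»: `[IsLocalRing R]`), let `A` be an abelian scheme whose finite sets of points lie in affine opens (automatic over a field or an Artin local
ring), and `i : Z ↪ A` a closed immersion with `Z → Spec R` FINITE and FLAT through which the unit, the product of the two projections and the inverse
factor (a finite flat closed subgroup scheme).  Then there is an abelian scheme `Â` over `Spec R` and a homomorphism `π : A → Â` which is FINITE, FLAT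
and SURJECTIVE, whose kernel on `T`-valued points is exactly `Z` (`u ≫ π = 1 ↔ u` factors through `i`), and `Â` has relative dimension `g` whenever `A`
has: `Â := A⁄Z` is a scheme and `A → A⁄Z` an fppf `Z`-torsor (Thm. 27.68), `A⁄Z → Spec R` proper, flat, smooth with geometrically connected fibres
(Prop. 27.62 (4)) with the descended commutative group law, and `π` is an isogeny (Cor. 27.177 (1)).  Why it might fail: only by mis-statement — the
affine-orbit hypothesis is exactly SGA 3 V 4.1 (b); size XL (the ★ constant-group road `RelativeSpec/FreeQuotient*` ∕ `MumfordQuotientConstruction*` is the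
template). [cite: SGA3I, Exp. V Thm. 4.1] [cite: GortzWedhorn2023, Thm. 27.68, Prop. 27.62 and Cor. 27.177 (1)] [cite: MumfordAV1970, §12 Thm. 1 (p. 111)] -/
theorem stub_L4B1uQ_quotientByFiniteFlatSubgroup :
    ∀ (R : Type) [CommRing R] [IsNoetherianRing R] [IsLocalRing R] (A : AbelianSchemeOver (Spec (.of R))),
      (∀ F : Finset A.X.left, ∃ U : A.X.left.Opens, IsAffineOpen U ∧ ∀ x ∈ F, x ∈ U) →
      ∀ (Z : Over (Spec (.of R))) (i : Z ⟶ A.X), IsClosedImmersion i.left → IsFinite Z.hom → Flat Z.hom →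
        (∃ e : 𝟙_ (Over (Spec (.of R))) ⟶ Z, e ≫ i = 1) →
        (∃ m : Z ⊗ Z ⟶ Z, m ≫ i = (fst Z Z ≫ i) * (snd Z Z ≫ i)) →
        (∃ n : Z ⟶ Z, n ≫ i = i⁻¹) →
        ∃ (hat : AbelianSchemeOver (Spec (.of R))) (π : A.X ⟶ hat.X) (_ : IsMonHom π) (_ : IsFinite π.left) (_ : Flat π.left)
          (_ : Surjective π.left),
          (∀ (T : Over (Spec (.of R))) (u : T ⟶ A.X), u ≫ π = 1 ↔ ∃ v : T ⟶ Z, v ≫ i = u) ∧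
          ∀ g : ℕ, A.IsOfRelDim g → hat.IsOfRelDim g :=
  -- T2′ (desk F0P6b-plan (g14), LEAD «M-153u» (4)): PAID BY ★ TERM over the Literature re-home F1
  -- `AbelianSchemes/CechH1CountOfFiniteFlatQuotient.lean` («L2» LA2-p04 (g10)); the 90-line torsor-quotient body lives there now.
  fun R _ _ _ A hcov Z i hci hZfin hZflat he hm hn =>
    @AbelianSchemeOver.exists_quotient_of_finiteFlat_closedSubgroup R _ _ _ A hcov Z i hci hZfin hZflat he hm hn

/-! ## §D (PAID BY ★ TERM, ED. 4) Descent of the Mumford bundle `Λ(L)` to the Poincaré sheaf on `A × A⁄K(L)` -/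

/-- **§D `stub_L4B1uD` (PAID BY ★ TERM, ED. 4 — [MumfordAV1970] §13, proof of the Theorem (pp. 125–127); §8 (p. 77)).**  Over an algebraically closed field `K`, let
`π : A → Â` be a FINITE FLAT SURJECTIVE homomorphism of abelian schemes whose kernel on `T`-valued points is `K(L)` for a rank-one `L` on `A` rigidified
along the unit section.  Then there is a rank-one `𝒫` on `A × Â` with `(1 × π)^*𝒫 ≅ Λ(L) = m^*L ⊗ pr₁^*L⁻¹ ⊗ pr₂^*L⁻¹` and every slice `𝒫|_{A × {b}}`
(`b ∈ Â(K)`) in `Pic⁰(A)`: `1 × π : A × A → A × Â` is an fppf `{0} × K(L)`-torsor (`Â ≅ A⁄K(L)`, [GortzWedhorn2023] Prop. 27.176), `Λ(L)|_{A × K(L)}` is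
trivial by the definition of `K(L)` and canonically so by the rigidification, the cocycle condition holds by rigidity (`A` proper and connected), and
the slice over `b = π(a)` pulls back to `Λ(L)|_{A × {a}} ≅ t_a^*L ⊗ L⁻¹ ∈ Pic⁰`.  Why it might fail: the descent datum must be the RIGIDIFIED
trivialisation (an arbitrary one is off by a character of `K(L)`); size L–XL (★ twin for constant `K(L)`: `MumfordQuotientPoincare`; new organ: descent of a
rank-one module along a finite FLAT torsor, Mathlib `Morphisms/FlatDescent`). [cite: MumfordAV1970, §13 Theorem (p. 125) and its proof (pp. 125–127); §8 (p. 77)]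
[cite: GortzWedhorn2023, Prop. 27.176 and Prop. 27.62 (2)] -/
theorem stub_L4B1uD_mumfordLambdaDescent :
    ∀ (K : Type) [Field K] [IsAlgClosed K] (A hat : AbelianSchemeOver (Spec (.of K))) (π : A.X ⟶ hat.X),
      IsMonHom π → IsFinite π.left → Flat π.left → Surjective π.left →
      ∀ (L : A.left.Modules) (hL : HasRank L 1),
        CechPic.pullback A.unitSection (detClass (HasRank.isFiniteLocallyFree' hL)) = 1 →
        (∀ (T : Over (Spec (.of K))) (u : T ⟶ A.X), u ≫ π = 1 ↔ A.MemKOfL L u) →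
        ∃ (P : (A.prodLeft hat).Modules) (_ : HasRank P 1),
          (∀ b : Spec (.of K) ⟶ hat.X.left,
            IsHomogeneous (A.fibre (b ≫ hat.X.hom)).toAbelianVariety ((Scheme.Modules.pullback (A.fibreSlice hat b)).obj P)) ∧
          Nonempty ((Scheme.Modules.pullback (A.X ◁ π).left).obj P ≅ A.mumfordBundle L) := by
  intro K _ _ A hat π h₁ h₂ h₃ h₄ L hL hε hK
  haveI := h₁; haveI := h₂; haveI := h₃; haveI := h₄
  exact A.exists_poincare_of_finiteFlatKernel hat π hL hε hK

/-! ## Glue (kernel-checked; no `sorry` below this line) -/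

/-- **FLAT POINCARÉ DATA OVER EVERY ALGEBRAICALLY CLOSED FIELD, from §Q and §D** — the hypothesis of ★ `MumfordDual.hH1_of_forall_flatPoincareData`:
★ `exists_rankOne_kOfL_closedSubgroup` gives `L` (rank one, rigidified, ample class on geometric fibres) with `K(L)` a finite closed subgroup scheme
`Z ↪ A`; `Z → Spec K` is flat (field base) and finite sets of points of the projective `A` lie in affine opens (★ `AbelianVariety.isProjectiveOver_holds`,
★ `Morphisms.exists_isAffineOpen_forall_mem_of_isProjective`); §Q gives `(Â, π)` with kernel `Z = K(L)` and `Â` of relative dimension `g`; §D gives `𝒫`.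
[cite: MumfordAV1970, §13 Theorem (p. 125) and §12 Thm. 1 (p. 111)] -/
theorem forall_flatPoincareData_of_stubs
    (hQ : type_of% @stub_L4B1uQ_quotientByFiniteFlatSubgroup) (hD : type_of% @stub_L4B1uD_mumfordLambdaDescent) :
    ∀ (K : Type) [Field K] [IsAlgClosed K] (A : AbelianSchemeOver (Spec (.of K))) (g : ℕ), A.IsOfRelDim g →
      ∃ (L : A.left.Modules) (hL : HasRank L 1) (_ : CechPic.pullback A.unitSection (detClass (HasRank.isFiniteLocallyFree' hL)) = 1)
        (hat : AbelianSchemeOver (Spec (.of K))) (_ : hat.IsOfRelDim g) (π : A.X ⟶ hat.X) (_ : IsMonHom π) (_ : Flat π.left)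
        (_ : Surjective π.left) (P : (A.prodLeft hat).Modules) (_ : HasRank P 1),
        (∀ (T : Over (Spec (.of K))) (u : T ⟶ A.X), u ≫ π = 1 ↔ A.MemKOfL L u) ∧
        (∀ b : Spec (.of K) ⟶ hat.X.left,
          IsHomogeneous (A.fibre (b ≫ hat.X.hom)).toAbelianVariety ((Scheme.Modules.pullback (A.fibreSlice hat b)).obj P)) ∧
        Nonempty ((Scheme.Modules.pullback (A.X ◁ π).left).obj P ≅ A.mumfordBundle L) := by
  intro K _ _ A g hA
  obtain ⟨L, hL, hε, -, Z, i, hci, hZfin, hZ, he, hm, hn⟩ := A.exists_rankOne_kOfL_closedSubgroup K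
  -- finite sets of points of the projective `A` lie in affine opens
  have hproj : Morphisms.IsProjective A.X.hom :=
    Morphisms.IsProjective.of_isProjectiveOver (AbelianVariety.isProjectiveOver_holds A.toAffine.toAbelianVariety)
  have hfin : ∀ F : Finset A.X.left, ∃ U : A.X.left.Opens, IsAffineOpen U ∧ ∀ x ∈ F, x ∈ U := fun F =>
    Morphisms.exists_isAffineOpen_forall_mem_of_isProjective hproj F
  -- `Z → Spec K` is flat (one-point integral base)
  haveI : Subsingleton ↥(Spec (CommRingCat.of K)) := inferInstanceAs (Subsingleton (PrimeSpectrum K))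
  have hZflat : Flat Z.hom := inferInstance
  obtain ⟨hat, π, hπmon, hπfin, hπflat, hπsurj, hker, hrd⟩ := hQ K A hfin Z i hci hZfin hZflat he hm hn
  have hker' : ∀ (T : Over (Spec (.of K))) (u : T ⟶ A.X), u ≫ π = 1 ↔ A.MemKOfL L u := fun T u => (hker T u).trans (hZ T u)
  obtain ⟨P, hP1, hpic, hsock⟩ := hD K A hat π hπmon hπfin hπflat hπsurj L hL hε hker'
  exact ⟨L, hL, hε, hat, hrd g hA, π, hπmon, hπflat, hπsurj, P, hP1, hker', hpic, hsock⟩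

/-- **THE PARENT'S BANKED SOCKET §1 FROM §Q AND §D (kernel-checked junction).**  `stub_L4B1u_abelianLiftOfIsUnitTwo` of
`Lines/F0_P6b_BTSerreTate.lean` — unconditional abelian lifting over Artin local bases with `2 ∈ A^×` — follows from the quotient stub §Q and the descent
stub §D: ★ `MumfordDual.hH1_of_forall_flatPoincareData` turns their flat Poincaré data into the H¹-count letter `dim B ≤ dim_k Ȟ¹(𝔘, 𝒪_B) + 1` for every
abelian scheme over every field, and ★ p852865 `AbelianSchemeOver.exists_abelianLift_of_isUnit_two` (the parent's §1b road) does the rest.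
ED. 2 (DAYLIGHT re-cut): the conclusion is the §1 socket statement SPELLED OUT (no `type_of%` into the parent, which now imports THIS file and
pays §1 BY TERM: `theorem stub_L4B1u_abelianLiftOfIsUnitTwo … := F0P6bFlatQuotient.stub_L4B1u_of_flatQuotient_of_descent stub_L4B1uQ_… stub_L4B1uD_…`).
[cite: MumfordAV1970, §13 Cor. 2 (p. 129)] [cite: Oort1971, Theorem (2.2.1) (p. 273)] -/
theorem stub_L4B1u_of_flatQuotient_of_descent
    (hQ : type_of% @stub_L4B1uQ_quotientByFiniteFlatSubgroup) (hD : type_of% @stub_L4B1uD_mumfordLambdaDescent) :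
    ∀ (A : Type) [CommRing A] [IsArtinianRing A] [IsLocalRing A], IsUnit (2 : A) →
      ∀ (J : Ideal A), J ≠ ⊤ → maximalIdeal A * J = ⊥ →
      ∀ (g : ℕ) (X₀ : AbelianSchemeOver (Spec (.of (A ⧸ J)))), X₀.IsOfRelDim g →
        ∃ (X : AbelianSchemeOver (Spec (.of A))) (_ : X.IsOfRelDim g) (G : X₀.X.left ⟶ X.X.left),
          X₀.IsBaseChangeVia X (Spec.map (CommRingCat.ofHom (Ideal.Quotient.mk J))) G :=
  fun _ _ _ _ h2 J hJ _ _ X₀ hg =>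
    AbelianSchemeOver.exists_abelianLift_of_isUnit_two J hJ h2
      (MumfordDual.hH1_of_forall_flatPoincareData (forall_flatPoincareData_of_stubs hQ hD)) X₀ hg

end Summit.HodgeConjecture.HodgeConjecture.Cruxes.HLiu418.F0P6bFlatQuotient
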